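import Summits.BirchSwinnertonDyer.Rank1Residual.AdditivePotMult.TwistPointsOver
import Summits.BirchSwinnertonDyer.Rank1Residual.Additive.RationalLineOfKernelPolynomial
import HarnessLib

/-!
# The point identification `E(ℚ̄) ≃ V(ℚ̄)` of a twist model `C • V^{(c)} = W`, with its sign rule
# (`Gal(ℚ̄/K)`-equivariant, anti-equivariant off it) and its ABSCISSA relation; restriction to `E[p]`
# (cell `bsd-addord`, seat `bsd-addord-twist`; File C of the Φ₀ kernel-records programme, transport part)

HONEST FRAMING (cell `bsd-addord`, `run/shared/lean/pub/bsd-addord/README.md` §4): the programme's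
target of record is the full Birch–Swinnerton-Dyer formula for every `E/ℚ` of analytic rank `≤ 1`;
this is a TOOL file (composition of the tree's explicit point isomorphisms; theorems only, no
definition, no named fact, no `sorry`). It books nothing.

## What

For `C • V^{(c)} = W` over `ℚ` and a quadratic field `K = ℚ(θ)`, `θ² = c`, the composite
`E(ℚ̄) → (C • V^{(c)})(ℚ̄) → V^{(c)}(ℚ̄) → V(ℚ̄)` of the tree's `Affine.Point.congrEquiv`,
`VariableChange.pointEquivBaseChange` (Silverman *AEC* III.1: `x' = u⁻²(x − r)`) and additive-p1's
`twistGeomEquiv` (`(X, Y) ↦ (X/t², Y/t³)` onto `V^{(1)}`, then un-completing the square `sqChange V`;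
`t = rootInClosure K θ`) is an additive isomorphism which is `Gal(ℚ̄/K)`-EQUIVARIANT and
ANTI-equivariant off `Gal(ℚ̄/K)` (`twistGeomEquiv_smul_of_mem` / `_of_not_mem`), and whose
abscissa is explicit: for `(x, y) ↦ (x_V, y_V)` there is `x_d` with `x = u⁻²(x_d − r)` and
`u₂⁻²(x_V − r₂) = t⁻² x_d` (`(u, r) ∈ C`, `(u₂, r₂) ∈ sqChange V`):
**`exists_pointEquiv_of_twist_model`**, and on `p`-torsion **`exists_torsionEquiv_of_twist_model`**
(cf. the coordinate-free `exists_signEquiv_of_twist` of `GVParityTwistTransportProofs`).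

Consumer: `Additive/RationalLineTwistRamifiedOfKernelPolynomial.lean` (the `hram` column of the
Φ₀ line datum at `p ≥ 5`).

References: J. H. Silverman, *AEC* 2nd ed., III.1 Table 3.1, X.5 Cor. 5.4 [SilvermanAEC2009];
T. Dokchitser, *Notes on the parity conjecture* (2013) §4 [Dokchitser2013ParityNotes].
-/

set_option autoImplicit false

noncomputable section

open scoped Classical NumberField

open WeierstrassCurve Polynomial Literature.NumberTheory.EllipticCurves
  Literature.NumberTheory.EllipticCurves.Rank1Residual Literature.NumberTheory.GaloisRepresentations
  Field IsDedekindDomain NumberField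
  Summit.BirchSwinnertonDyer.Rank1Residual.AdditivePotMult

namespace Summit.BirchSwinnertonDyer.Rank1Residual.Additive.KernelPolyLine

/-! ## §1 The twist-model identification `E(ℚ̄) ≃ V(ℚ̄)` with its sign rule and its coordinates -/

section Transport

variable {W V : WeierstrassCurve ℚ} {c : ℚ} {C : VariableChange ℚ}
  (K : Type) [Field K] [NumberField K] {θ : K}
  (hθ : θ ∉ Set.range (algebraMap ℚ K)) (hc : θ ^ 2 = algebraMap ℚ K c)
  (hC : C • V.quadraticTwist c = W)

/-- `toX` of a base-changed change of variables: `(C_L).toX x = u⁻² (x − r)` with `u, r` mapped.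
[folklore] -/
theorem toX_map_eq {L : Type*} [Field L] [Algebra ℚ L] (D : VariableChange ℚ) (x : L) :
    (D.map (algebraMap ℚ L)).toX x =
      algebraMap ℚ L ((D.u⁻¹ : ℚˣ) : ℚ) ^ 2 * (x - algebraMap ℚ L D.r) := by
  rw [VariableChange.toX_def]
  simp only [VariableChange.map, Units.val_inv_eq_inv_val, MonoidHom.coe_coe, Units.coe_map, map_inv₀]

include hθ hc hC in
/-- **The point identification `E(ℚ̄) ≃+ V(ℚ̄)` of a twist model `C • V^{(c)} = W`, with its sign
rule and its abscissa.** There is an additive isomorphism `E : E(ℚ̄) ≃+ V(ℚ̄)`, `Gal(ℚ̄/K)`-equivariant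
and anti-equivariant off `Gal(ℚ̄/K)` (`K = ℚ(θ)`, `θ² = c`), such that for `(x, y) ∈ E(ℚ̄)` with
`E(x, y) = (x_V, y_V)`: `x = u⁻²(x_d − r)` and `u₂⁻²(x_V − r₂) = t⁻² x_d` for some `x_d`, where
`(u, r) ∈ C`, `(u₂, r₂) ∈ sqChange V`, `t = rootInClosure K θ` (`t² = c`).
[cite: SilvermanAEC2009, X.5 Cor. 5.4] -/
theorem exists_pointEquiv_of_twist_model (h2 : Module.finrank ℚ K = 2) :
    ∃ E : W.geomPoints ≃+ V.geomPoints,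
      (∀ g : absoluteGaloisGroup ℚ, g ∈ galRange (K := ℚ) K → ∀ P, E (g • P) = g • E P) ∧
      (∀ g : absoluteGaloisGroup ℚ, g ∉ galRange (K := ℚ) K → ∀ P, E (g • P) = -(g • E P)) ∧
      (∀ (x y : AlgebraicClosure ℚ) (hxy : (W.baseChange (AlgebraicClosure ℚ)).toAffine.Nonsingular x y),
        ∃ (xd xV yV : AlgebraicClosure ℚ)
          (hV : (V.baseChange (AlgebraicClosure ℚ)).toAffine.Nonsingular xV yV),
          E (Affine.Point.some x y hxy) = Affine.Point.some xV yV hV ∧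
          x = algebraMap ℚ (AlgebraicClosure ℚ) ((C.u⁻¹ : ℚˣ) : ℚ) ^ 2 *
            (xd - algebraMap ℚ (AlgebraicClosure ℚ) C.r) ∧
          algebraMap ℚ (AlgebraicClosure ℚ) (((sqChange V).u⁻¹ : ℚˣ) : ℚ) ^ 2 *
            (xV - algebraMap ℚ (AlgebraicClosure ℚ) (sqChange V).r) =
            (rootInClosure K θ)⁻¹ ^ 2 * xd) := by
  let e₁ : W.geomPoints ≃+ (C • V.quadraticTwist c).geomPoints :=
    Affine.Point.congrEquiv
      (congrArg (fun Z : WeierstrassCurve ℚ ↦ Z.baseChange (AlgebraicClosure ℚ)) hC.symm)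
  let E' : (V.quadraticTwist c).geomPoints ≃+ (C • V.quadraticTwist c).geomPoints :=
    VariableChange.pointEquivBaseChange (V.quadraticTwist c) C (AlgebraicClosure ℚ)
  let e₃ : (V.quadraticTwist c).geomPoints ≃+ V.geomPoints := twistGeomEquiv V K hθ hc
  have h₁ : ∀ (g : absoluteGaloisGroup ℚ) (P : W.geomPoints), e₁ (g • P) = g • e₁ P := fun g P ↦
    congrEquiv_smul_of_eq hC.symm (absoluteGaloisGroup.toAlgEquiv ℚ g) P
  have hE' : ∀ (g : absoluteGaloisGroup ℚ) (Q : (V.quadraticTwist c).geomPoints),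
      E' (g • Q) = g • E' Q := fun g Q ↦
    VariableChange.pointEquivBaseChange_map_algEquiv (V.quadraticTwist c) C
      (absoluteGaloisGroup.toAlgEquiv ℚ g) Q
  have h₂ : ∀ (g : absoluteGaloisGroup ℚ) (Q : (C • V.quadraticTwist c).geomPoints),
      E'.symm (g • Q) = g • E'.symm Q := by
    intro g Q
    apply E'.injective
    rw [AddEquiv.apply_symm_apply, hE', AddEquiv.apply_symm_apply]
  refine ⟨(e₁.trans E'.symm).trans e₃, ?_, ?_, ?_⟩
  · intro g hg P
    simp only [AddEquiv.trans_apply]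
    rw [h₁, h₂, twistGeomEquiv_smul_of_mem V K hθ hc hg]
  · intro g hg P
    simp only [AddEquiv.trans_apply]
    rw [h₁, h₂, twistGeomEquiv_smul_of_not_mem V K h2 hθ hc hg]
  · intro x y hxy
    -- through `e₁`: same coordinates
    have he₁ : e₁ (Affine.Point.some x y hxy) = Affine.Point.some x y
        ((congrArg (fun Z : WeierstrassCurve ℚ ↦ Z.baseChange (AlgebraicClosure ℚ)) hC.symm) ▸ hxy) :=
      Affine.Point.congrEquiv_some _ hxy
    -- through `E'⁻¹`: `x = C_L.toX x_d`
    have hQ0 : E'.symm (e₁ (Affine.Point.some x y hxy)) ≠ 0 := by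
      intro h0
      have h1 : e₁ (Affine.Point.some x y hxy) = 0 := by
        have h2' := congrArg E' h0
        rwa [AddEquiv.apply_symm_apply, map_zero] at h2'
      rw [he₁] at h1
      exact Affine.Point.some_ne_zero _ h1
    obtain ⟨xd, yd, hd, hQe⟩ := exists_eq_some_of_ne_zero hQ0
    have hx : x = (C.map (algebraMap ℚ (AlgebraicClosure ℚ))).toX xd := by
      have h1 : E' (E'.symm (e₁ (Affine.Point.some x y hxy))) = e₁ (Affine.Point.some x y hxy) :=
        AddEquiv.apply_symm_apply _ _
      rw [hQe, he₁] at h1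
      dsimp only [E'] at h1
      erw [VariableChange.pointEquivBaseChange_some] at h1
      exact (Affine.Point.some.inj h1).1.symm
    -- through `e₃ = (step 2)⁻¹ ∘ (step 1)`
    have hR0 : e₃ (E'.symm (e₁ (Affine.Point.some x y hxy))) ≠ 0 := by
      intro h0
      exact hQ0 (e₃.injective (by rw [h0, map_zero]))
    obtain ⟨xV, yV, hV', hRe⟩ := exists_eq_some_of_ne_zero hR0
    have ht : rootInClosure K θ ∉ Set.range (algebraMap ℚ (AlgebraicClosure ℚ)) :=
      rootInClosure_not_mem K hθ
    have htc : rootInClosure K θ ^ 2 = algebraMap ℚ (AlgebraicClosure ℚ) c := rootInClosure_sq K hc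
    have hstep : twistStepTwo V (e₃ (E'.symm (e₁ (Affine.Point.some x y hxy)))) =
        twistStepOne V ht htc (E'.symm (e₁ (Affine.Point.some x y hxy))) := by
      change twistStepTwo V (twistPointEquivOver V ht htc _) = _
      rw [twistPointEquivOver_apply, AddEquiv.apply_symm_apply]
    rw [hRe, hQe] at hstep
    erw [twistStepTwo_some, twistStepOne_some] at hstep
    simp only [Affine.Point.some.injEq] at hstep
    have hx1 : ((sqChange V).map (algebraMap ℚ (AlgebraicClosure ℚ))).toX xV =
        (rootInClosure K θ)⁻¹ ^ 2 * xd := by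
      rw [hstep.1, (toX_toY_twistUntwist ht xd yd).1]
    refine ⟨xd, xV, yV, hV', ?_, ?_, ?_⟩
    · simp only [AddEquiv.trans_apply]
      exact hRe
    · rw [hx, toX_map_eq]
    · rw [← toX_map_eq, hx1]


include hθ hc hC in
/-- **The same identification on `p`-torsion**, `e : E[p] ≃+ V[p]`, with the sign rule and the
abscissa relation. [cite: SilvermanAEC2009, X.5 Cor. 5.4] -/
theorem exists_torsionEquiv_of_twist_model (p : ℕ) [Fact p.Prime] (h2 : Module.finrank ℚ K = 2) :
    ∃ e : geomTorsion W (p : ℤ) ≃+ geomTorsion V (p : ℤ),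
      (∀ g : absoluteGaloisGroup ℚ, g ∈ galRange (K := ℚ) K → ∀ T, e (g • T) = g • e T) ∧
      (∀ g : absoluteGaloisGroup ℚ, g ∉ galRange (K := ℚ) K → ∀ T, e (g • T) = -(g • e T)) ∧
      (∀ (T : geomTorsion W (p : ℤ)) (x y : AlgebraicClosure ℚ)
        (hxy : (W.baseChange (AlgebraicClosure ℚ)).toAffine.Nonsingular x y),
        (T : W.geomPoints) = Affine.Point.some x y hxy →
        ∃ (xd xV yV : AlgebraicClosure ℚ)
          (hV : (V.baseChange (AlgebraicClosure ℚ)).toAffine.Nonsingular xV yV),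
          ((e T : geomTorsion V (p : ℤ)) : V.geomPoints) = Affine.Point.some xV yV hV ∧
          x = algebraMap ℚ (AlgebraicClosure ℚ) ((C.u⁻¹ : ℚˣ) : ℚ) ^ 2 *
            (xd - algebraMap ℚ (AlgebraicClosure ℚ) C.r) ∧
          algebraMap ℚ (AlgebraicClosure ℚ) (((sqChange V).u⁻¹ : ℚˣ) : ℚ) ^ 2 *
            (xV - algebraMap ℚ (AlgebraicClosure ℚ) (sqChange V).r) =
            (rootInClosure K θ)⁻¹ ^ 2 * xd) := by
  obtain ⟨F, hFpos, hFneg, hFcoord⟩ := exists_pointEquiv_of_twist_model K hθ hc hC h2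
  have hmem : ∀ T : geomTorsion W (p : ℤ), F T ∈ geomTorsion V (p : ℤ) := by
    intro T
    rw [AddSubgroup.torsionBy.nsmul_iff, ← map_nsmul, AddSubgroup.torsionBy.nsmul_iff.mp T.2,
      map_zero]
  let φ : geomTorsion W (p : ℤ) →+ geomTorsion V (p : ℤ) :=
    AddMonoidHom.codRestrict ((F : W.geomPoints →+ V.geomPoints).comp
      (geomTorsion W (p : ℤ)).subtype) (geomTorsion V (p : ℤ)) hmem
  have hφ : ∀ T, ((φ T : geomTorsion V (p : ℤ)) : V.geomPoints) = F T := fun T ↦ rfl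
  have hφinj : Function.Injective φ := by
    intro T₁ T₂ h
    have h' := congrArg (fun S : geomTorsion V (p : ℤ) ↦ (S : V.geomPoints)) h
    simp only [hφ] at h'
    exact Subtype.ext (F.injective h')
  have hφsurj : Function.Surjective φ := by
    intro S
    have hS : F.symm S ∈ geomTorsion W (p : ℤ) := by
      rw [AddSubgroup.torsionBy.nsmul_iff]
      apply F.injective
      rw [map_nsmul, AddEquiv.apply_symm_apply, map_zero]
      exact AddSubgroup.torsionBy.nsmul_iff.mp S.2
    refine ⟨⟨F.symm S, hS⟩, Subtype.ext ?_⟩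
    rw [hφ]
    exact F.apply_symm_apply S
  refine ⟨AddEquiv.ofBijective φ ⟨hφinj, hφsurj⟩, ?_, ?_, ?_⟩
  · intro g hg T
    exact Subtype.ext (by
      rw [AddSubgroup.torsionBy.coe_smul]
      change F (((g • T : geomTorsion W (p : ℤ))) : W.geomPoints) = g • F T
      rw [AddSubgroup.torsionBy.coe_smul, hFpos g hg])
  · intro g hg T
    exact Subtype.ext (by
      rw [AddSubgroup.coe_neg, AddSubgroup.torsionBy.coe_smul]
      change F (((g • T : geomTorsion W (p : ℤ))) : W.geomPoints) = -(g • F T)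
      rw [AddSubgroup.torsionBy.coe_smul, hFneg g hg])
  · intro T x y hxy hT
    obtain ⟨xd, xV, yV, hV', hE, hx, hx1⟩ := hFcoord x y hxy
    refine ⟨xd, xV, yV, hV', ?_, hx, hx1⟩
    change F (T : W.geomPoints) = _
    rw [hT]
    exact hE

end Transport

end Summit.BirchSwinnertonDyer.Rank1Residual.Additive.KernelPolyLine

end
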